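import Literature.NumberTheory.Transcendental.DirectionalJets
import Mathlib.Analysis.Normed.Operator.Bilinear
import HarnessLib

/-!
# Nested iterated derivatives and separated two-variable jets

Topic: `Literature/NumberTheory/Transcendental`. Plan item W4/S5(c) of the unit
`provefact-Literature.NumberTheory.Transcendental.H-b596640137`. The extrapolation functions of
Baker's method are `φ_{x,k}(z) = d^k/dξ^k F(z·v + ξ·x)|_{ξ=0}`; their `z`-jets at a point are
SEPARATED mixed derivatives of `F`. PROVED here (generic, Mathlib only):

* `iteratedFDeriv_iteratedFDeriv_apply` — **nested iterated derivatives**: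
  `D^j(D^k f)(x)(u)(m) = D^{j+k} f(x)(u ⧺ m)` for `C^∞`/`C^ω` maps;
* `iteratedDeriv_iteratedDeriv_line` — for a `C^ω` map,
  `d^j/dz^j [ d^k/dξ^k f(w + z·v + ξ·x)|_{ξ=0} ]|_{z=0} = D^{j+k}f(w)(v, …, v, x, …, x)`;
* `iteratedDeriv_iteratedDeriv_line_eq_zero` — hence, if all line jets of `f` of orders `< N`
  along a subspace `U ∋ v, x` vanish at `w` (`DirectionalJets.lean`), these separated jets vanish
  for `j + k < N`: the function `z ↦ φ_{x,k}` restricted to the line through `w` has a zero of order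
  `≥ N - k` there.

## References

* A. Baker, G. Wüstholz, *Logarithmic Forms and Diophantine Geometry*, CUP 2007, §6.8 (p. 119).
-/

noncomputable section

open scoped ContDiff
open Fin

namespace Literature.NumberTheory.Transcendental

section Nested

variable {𝕜 : Type*} [NontriviallyNormedField 𝕜] {E F : Type*} [NormedAddCommGroup E]
  [NormedSpace 𝕜 E] [NormedAddCommGroup F] [NormedSpace 𝕜 F]

/-- Evaluating the iterated derivative of a multilinear-map-valued function at a fixed tuple
commutes with differentiation. [folklore] -/
theorem iteratedFDeriv_apply_const {ι : Type*} [Fintype ι] {G : ι → Type*}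
    [∀ i, NormedAddCommGroup (G i)] [∀ i, NormedSpace 𝕜 (G i)]
    {g : E → ContinuousMultilinearMap 𝕜 G F} (hg : ContDiff 𝕜 ω g) (j : ℕ) (x : E) (u : Fin j → E)
    (m : ∀ i, G i) :
    iteratedFDeriv 𝕜 j g x u m = iteratedFDeriv 𝕜 j (fun y => g y m) x u := by
  have h := (ContinuousMultilinearMap.apply 𝕜 G F m).iteratedFDeriv_comp_left (hg.contDiffAt (x := x)) (i := j) le_top
  have e : (⇑(ContinuousMultilinearMap.apply 𝕜 G F m) ∘ g) = fun y => g y m := by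
    funext y; simp [ContinuousMultilinearMap.apply]
  rw [e] at h
  rw [h]
  rfl

/-- Evaluating the iterated derivative of an operator-valued function at a fixed vector commutes
with differentiation. [folklore] -/
theorem iteratedFDeriv_clm_apply_const {G : Type*} [NormedAddCommGroup G] [NormedSpace 𝕜 G]
    {g : E → G →L[𝕜] F} (hg : ContDiff 𝕜 ω g) (j : ℕ) (x : E) (u : Fin j → E) (e : G) :
    iteratedFDeriv 𝕜 j g x u e = iteratedFDeriv 𝕜 j (fun y => g y e) x u := by
  have h := (ContinuousLinearMap.apply 𝕜 F e).iteratedFDeriv_comp_left (hg.contDiffAt (x := x)) (i := j) le_top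
  have he : (⇑(ContinuousLinearMap.apply 𝕜 F e) ∘ g) = fun y => g y e := by
    funext y; simp
  rw [he] at h
  rw [h]
  rfl

/-- **Nested iterated derivatives.** For a `C^ω` map: `D^j(D^k f)(x)(u)(m) = D^{j+k}f(x)(u ⧺ m)`
(the inner derivative eats the last `k` vectors). [folklore] -/
theorem iteratedFDeriv_iteratedFDeriv_apply (k : ℕ) :
    ∀ {f : E → F} (_ : ContDiff 𝕜 ω f) (j : ℕ) (x : E) (u : Fin j → E) (m : Fin k → E),
      iteratedFDeriv 𝕜 j (iteratedFDeriv 𝕜 k f) x u m =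
        iteratedFDeriv 𝕜 (j + k) f x (Fin.append u m) := by
  induction k with
  | zero =>
    intro f hf j x u m
    have happ : Fin.append u m = u := funext fun i => Fin.append_left u m i
    have hfun : iteratedFDeriv 𝕜 0 f =
        ⇑((continuousMultilinearCurryFin0 𝕜 E F).symm.toContinuousLinearEquiv) ∘ f := iteratedFDeriv_zero_eq_comp
    rw [hfun, (continuousMultilinearCurryFin0 𝕜 E F).symm.toContinuousLinearEquiv.iteratedFDeriv_comp_left]
    simp only [ContinuousLinearMap.compContinuousMultilinearMap_coe, Function.comp_apply]
    show ((continuousMultilinearCurryFin0 𝕜 E F).symm (iteratedFDeriv 𝕜 j f x u)) m = _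
    rw [continuousMultilinearCurryFin0_symm_apply_apply]
    exact congrArg _ happ.symm
  | succ k ih =>
    intro f hf j x u m
    have hDk1 : ContDiff 𝕜 ω (iteratedFDeriv 𝕜 (k + 1) f) := hf.iteratedFDeriv_right le_top
    -- the fixed-direction derivative `∂_e f`, `e = m last`
    set e : E := m (Fin.last k) with he
    have hfe : ContDiff 𝕜 ω (fun y => fderiv 𝕜 f y e) :=
      (ContinuousLinearMap.apply 𝕜 F e).contDiff.comp (hf.fderiv_right le_top)
    have hDke : ContDiff 𝕜 ω (iteratedFDeriv 𝕜 k fun y => fderiv 𝕜 f y e) := hfe.iteratedFDeriv_right le_top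
    -- `D^{k+1} f y m = D^k (∂_e f) y (init m)`
    have hpt : ∀ y, iteratedFDeriv 𝕜 (k + 1) f y m = iteratedFDeriv 𝕜 k (fun z => fderiv 𝕜 f z e) y (Fin.init m) := by
      intro y
      rw [iteratedFDeriv_succ_apply_right]
      exact iteratedFDeriv_clm_apply_const (hf.fderiv_right le_top) k y (Fin.init m) e
    calc iteratedFDeriv 𝕜 j (iteratedFDeriv 𝕜 (k + 1) f) x u m
        = iteratedFDeriv 𝕜 j (fun y => iteratedFDeriv 𝕜 (k + 1) f y m) x u :=
          iteratedFDeriv_apply_const hDk1 j x u m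
      _ = iteratedFDeriv 𝕜 j (fun y => iteratedFDeriv 𝕜 k (fun z => fderiv 𝕜 f z e) y (Fin.init m)) x u := by
          simp_rw [hpt]
      _ = iteratedFDeriv 𝕜 j (iteratedFDeriv 𝕜 k fun z => fderiv 𝕜 f z e) x u (Fin.init m) :=
          (iteratedFDeriv_apply_const hDke j x u (Fin.init m)).symm
      _ = iteratedFDeriv 𝕜 (j + k) (fun z => fderiv 𝕜 f z e) x (Fin.append u (Fin.init m)) :=
          ih hfe j x u (Fin.init m)
      _ = iteratedFDeriv 𝕜 (j + k) (fderiv 𝕜 f) x (Fin.append u (Fin.init m)) e :=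
          (iteratedFDeriv_clm_apply_const (hf.fderiv_right le_top) (j + k) x _ e).symm
      _ = iteratedFDeriv 𝕜 (j + (k + 1)) f x (Fin.append u m) := by
          show _ = iteratedFDeriv 𝕜 ((j + k) + 1) f x (Fin.append (m := j) (n := k + 1) u m)
          rw [iteratedFDeriv_succ_apply_right]
          have htup : Fin.init (Fin.append (m := j) (n := k + 1) u m) = Fin.append u (Fin.init m) := by
            funext i
            refine Fin.addCases (fun i' => ?_) (fun i' => ?_) i
            · rw [Fin.append_left]
              simp only [Fin.init]
              have : (Fin.castSucc (Fin.castAdd k i') : Fin (j + (k + 1))) = Fin.castAdd (k + 1) i' :=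
                Fin.ext rfl
              rw [this, Fin.append_left]
            · rw [Fin.append_right]
              simp only [Fin.init]
              have : (Fin.castSucc (Fin.natAdd j i') : Fin (j + (k + 1))) = Fin.natAdd j (Fin.castSucc i') :=
                Fin.ext rfl
              rw [this, Fin.append_right]
          have hlast : (Fin.append (m := j) (n := k + 1) u m) (Fin.last (j + k)) = e := by
            have : (Fin.last (j + k) : Fin (j + (k + 1))) = Fin.natAdd j (Fin.last k) := Fin.ext rfl
            rw [this, Fin.append_right]
          rw [htup, hlast]

/-- **Separated two-variable jets along lines.** For a `C^ω` map:
`d^j/dz^j [ d^k/dξ^k f(w + z·v + ξ·x)|_{ξ=0} ]|_{z=0} = D^{j+k}f(w)(v, …, v, x, …, x)`. [folklore] -/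
theorem iteratedDeriv_iteratedDeriv_line {f : E → F} (hf : ContDiff 𝕜 ω f) (w v x : E) (j k : ℕ) :
    iteratedDeriv j (fun z : 𝕜 => iteratedDeriv k (fun ξ : 𝕜 => f (w + z • v + ξ • x)) 0) 0 =
      iteratedFDeriv 𝕜 (j + k) f w (Fin.append (fun _ : Fin j => v) (fun _ : Fin k => x)) := by
  have hinner : ∀ z : 𝕜, iteratedDeriv k (fun ξ : 𝕜 => f (w + z • v + ξ • x)) 0 =
      iteratedFDeriv 𝕜 k f (w + z • v) (fun _ => x) := fun z =>
    iteratedDeriv_line_eq_iteratedFDeriv hf (w + z • v) x le_top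
  simp_rw [hinner]
  have hg : ContDiff 𝕜 ω (fun y => iteratedFDeriv 𝕜 k f y (fun _ : Fin k => x)) :=
    (ContinuousMultilinearMap.apply 𝕜 (fun _ : Fin k => E) F (fun _ => x)).contDiff.comp
      (hf.iteratedFDeriv_right le_top)
  rw [iteratedDeriv_line_eq_iteratedFDeriv hg w v le_top,
    ← iteratedFDeriv_apply_const (hf.iteratedFDeriv_right le_top) j w _ (fun _ : Fin k => x),
    iteratedFDeriv_iteratedFDeriv_apply k hf j w]

end Nested

section Complex

variable {E F : Type*} [NormedAddCommGroup E] [NormedSpace ℂ E] [NormedAddCommGroup F] [NormedSpace ℂ F]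

/-- **Vanishing of the separated jets.** If all line jets of orders `< N` of the `C^ω` map `f`
along a subspace `U` vanish at `w` and `v, x ∈ U`, then for `j + k < N`
`d^j/dz^j [ d^k/dξ^k f(w + z·v + ξ·x)|_{ξ=0} ]|_{z=0} = 0`. [folklore] -/
theorem iteratedDeriv_iteratedDeriv_line_eq_zero {f : E → F} (hf : ContDiff ℂ ω f) (U : Submodule ℂ E)
    (w : E) (N : ℕ) (h : ∀ y ∈ U, ∀ k < N, iteratedDeriv k (fun t : ℂ => f (w + t • y)) 0 = 0)
    {v x : E} (hv : v ∈ U) (hx : x ∈ U) {j k : ℕ} (hjk : j + k < N) :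
    iteratedDeriv j (fun z : ℂ => iteratedDeriv k (fun ξ : ℂ => f (w + z • v + ξ • x)) 0) 0 = 0 := by
  rw [iteratedDeriv_iteratedDeriv_line hf]
  refine iteratedFDeriv_eq_zero_of_lineJets hf U w N h hjk _ fun i => ?_
  refine Fin.addCases (fun i' => ?_) (fun i' => ?_) i
  · rw [Fin.append_left]; exact hv
  · rw [Fin.append_right]; exact hx

end Complex

end Literature.NumberTheory.Transcendental

end
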